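import Literature.Topology.FourManifolds.ResolutionNeckPiece
import Literature.Topology.FourManifolds.BlowUpChartIdentities
import Literature.Topology.FourManifolds.BlowUpChartIdentitiesSheetTwo
import HarnessLib

/-!
# Zone agreements of the tube of `Σ̄₂ ⊂ T⁴ # ℂℙ²bar`

Topic `Literature/Topology/FourManifolds` (fact seat of the Seiberg–Witten leaf
`Literature.Barriers.SmoothPoincare4.akhmedovPark2010_lemma8_invariants`; block 2 of
Akhmedov–Park's `X₁(m)`, A. Akhmedov, B. D. Park, Invent. Math. 181 (2010), §3: "resolve the
double point `x₂ × y₀` and blow up at `x₃ × y₀`").  The tube of the genus-2 surface `Σ̄₂` in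
`Z = X # ℂℙ²` (`X = T⁴`, Kervaire–Milnor sum at the second double point through the plumbing chart
`P₃` and the affine chart `affineChart 2` of `ℂℙ²`) is assembled from local pieces — the
resolution neck `Nk` (`ResolutionNeckPiece.lean`), the product tubes `T₁`, `T₂` of the two sheets
with reparametrised fibres (`TubeFibreProfiles.lean`) and the two blow-up caps
(`BlowUpLineCapTube.lean`) — which must AGREE on the overlaps of their zones.  This file proves
the four agreements as identities between explicit formulas, with the local data bound by
hypotheses:

* `neck_eq_far` — outer neck zone `‖a₂‖ ≥ 3/4`: the neck piece with fibre scaled by `c ϱ₀ / k` is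
  the first sheet's product tube with fibre multiplied by `Ψ₁ = ϱ₀ conj â₂`;
* `neck_eq_arcFar` — inner neck zone `‖a₂‖ ≤ 1/4`: the neck piece is the SECOND sheet's tube at
  the Kervaire–Milnor partner parameter (same plumbing coordinates `(c ϱ₀ â₂ ṽ, (1 - ‖a₂‖) conj â₂)`);
* `cap_eq_far` — far cap zone `‖a₃‖ ≥ 2/3` of the first sheet: the cap point of `ℂℙ²` is the glued
  image of the first sheet's product tube with `Ψ₁ = (k₃/c) a₃`
  (`affineChart_two_symm_discInversion_sheetTube`);
* `cap₂_eq_arcFar` — the same for the second sheet's cap (`affineChart_two_symm_discInversion_sheetTube₂`).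

Everything is proved; no definitions.

## References

* A. Akhmedov, B. D. Park, Invent. Math. 181 (2010) 577–603 = arXiv:math/0701829, §3. [AkhmedovPark2010]
* M. Kervaire, J. Milnor, *Groups of homotopy spheres I*, Ann. of Math. 77 (1963), §2. [KervaireMilnor1963]
* D. McDuff, D. Salamon, *Introduction to Symplectic Topology*, 3rd ed. (2017), Ex. 7.1.4 (ii). [McDuffSalamon2017]
-/

noncomputable section

open scoped Manifold ContDiff Topology ComplexConjugate
open Set Function Complex
open Literature.Topology.FourManifolds.ToricBlowup
open Literature.Topology.FourManifolds.ComplexProjectiveSpace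

namespace Literature.Topology.FourManifolds

namespace TubeZones

/-! ### §0 Unit vectors -/

/-- The unit vector of a positive real multiple of a unit vector, and of its conjugate.
[folklore] -/
theorem unit_of_pos_mul {u : ℂ} (hu : ‖u‖ = 1) {t : ℝ} (ht : 0 < t) :
    ((‖((t : ℝ) : ℂ) * u‖⁻¹ : ℝ) : ℂ) * (((t : ℝ) : ℂ) * u) = u ∧
      conj (((‖((t : ℝ) : ℂ) * conj u‖⁻¹ : ℝ) : ℂ) * (((t : ℝ) : ℂ) * conj u)) = u := by
  have hn : ‖((t : ℝ) : ℂ) * u‖ = t := by rw [norm_mul, Complex.norm_real, Real.norm_eq_abs, abs_of_pos ht, hu, mul_one]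
  have hn' : ‖((t : ℝ) : ℂ) * conj u‖ = t := by
    rw [norm_mul, Complex.norm_real, Real.norm_eq_abs, abs_of_pos ht, Complex.norm_conj, hu, mul_one]
  have htc : ((t : ℝ) : ℂ) ≠ 0 := Complex.ofReal_ne_zero.2 ht.ne'
  constructor
  · rw [hn, ← mul_assoc, ← Complex.ofReal_mul, inv_mul_cancel₀ ht.ne', Complex.ofReal_one, one_mul]
  · rw [hn', map_mul, map_mul, Complex.conj_ofReal, Complex.conj_ofReal, Complex.conj_conj, ← mul_assoc,
      ← Complex.ofReal_mul, inv_mul_cancel₀ ht.ne', Complex.ofReal_one, one_mul]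

/-- A unit vector has norm one and its conjugate too; `conj (conj û) = û`. [folklore] -/
theorem norm_unit {a : ℂ} (ha : a ≠ 0) :
    ‖((‖a‖⁻¹ : ℝ) : ℂ) * a‖ = 1 ∧ ‖conj (((‖a‖⁻¹ : ℝ) : ℂ) * a)‖ = 1 := by
  have h : ‖((‖a‖⁻¹ : ℝ) : ℂ) * a‖ = 1 := by
    rw [norm_mul, Complex.norm_real, norm_inv, norm_norm, inv_mul_cancel₀ (norm_ne_zero_iff.2 ha)]
  exact ⟨h, by rw [Complex.norm_conj, h]⟩

/-! ### §1 The neck zones (plumbing chart `P = P₂` at the resolved double point) -/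

section Neck

variable {F : Type} [TopologicalSpace F] [ChartedSpace (EuclideanSpace ℝ (Fin 2)) F]
  {X : Type} [TopologicalSpace X] [ChartedSpace (EuclideanSpace ℝ (Fin 4)) X]
  {cx : EuclideanSpace ℝ (Fin 2) → ℂ} {vc : ℂ → EuclideanSpace ℝ (Fin 2)}
  {eF : OpenPartialHomeomorph F (EuclideanSpace ℝ (Fin 2))} {A : F → ℂ}
  {P : OpenPartialHomeomorph X (EuclideanSpace ℝ (Fin 4))}
  {T : F × EuclideanSpace ℝ (Fin 2) → X} {c : ℝ}
  {N : ℂ × ℂ → ℂ × ℂ} {k : ℝ}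
  {Nk : F × EuclideanSpace ℝ (Fin 2) → X}

variable (hcx : ∀ v, cx v = ⟨v 0, v 1⟩)
  (hvc : ∀ z, vc z = z.re • EuclideanSpace.single 0 (1 : ℝ) + z.im • EuclideanSpace.single 1 (1 : ℝ))
  (hPt : P.target = univ)
  (hc : 0 < c)
  (hPT : ∀ p, p ∈ eF.source → ∀ v : EuclideanSpace ℝ (Fin 2),
    T (p, v) ∈ P.source ∧ toC2 (P (T (p, v))) = (A p, (c : ℂ) * cx v))
  (hN2 : ∀ v ρ : ℂ, 3 / 4 ≤ ‖v‖ → N (v, ρ) = (v, conj (((‖v‖⁻¹ : ℝ) : ℂ) * v) * ρ))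
  (hN3 : ∀ v ρ : ℂ, ‖v‖ ≤ 1 / 4 → N (v, ρ) =
    ((((‖v‖⁻¹ : ℝ) : ℂ) * v) * ρ, conj (((‖v‖⁻¹ : ℝ) : ℂ) * v) * (((1 - ‖v‖ : ℝ)) : ℂ)))
  (hk : 0 < k)
  (hNk : ∀ (p : F) (w : EuclideanSpace ℝ (Fin 2)),
    Nk (p, w) = P.symm (fromC2 (N (A p, (k : ℂ) * cx w))))

omit [ChartedSpace (EuclideanSpace ℝ (Fin 2)) F] [ChartedSpace (EuclideanSpace ℝ (Fin 4)) X] in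
include hcx hvc hc hPT hN2 hk hNk in
/-- **Outer neck zone = first sheet's far piece.**  For `‖A p‖ ≥ 3/4` and a multiplier with
`Ψ p = ϱ₀ conj â` (`â = A p/‖A p‖`):  `Nk (p, (c ϱ₀ / k) ṽ) = T (p, vc (Ψ p · cx ṽ))`.
[cite: AkhmedovPark2010, §3] -/
theorem neck_eq_far {p : F} (hp : p ∈ eF.source) (hAp : 3 / 4 ≤ ‖A p‖) {Ψ : F → ℂ} {ϱ₀ : ℝ}
    (hΨ : Ψ p = ((ϱ₀ : ℝ) : ℂ) * conj (((‖A p‖⁻¹ : ℝ) : ℂ) * A p)) (w : EuclideanSpace ℝ (Fin 2)) :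
    Nk (p, (c * ϱ₀ / k) • w) = T (p, vc (Ψ p * cx w)) := by
  rw [NeckPiece.neckPiece_eq_tube_of_ge (hcx := hcx) (hvc := hvc) (hc := hc) (hPT := hPT) (hN2 := hN2)
    (hNk := hNk) hp hAp, NeckPiece.cx_smul hcx, hΨ]
  congr 3
  have hkc : ((k / c : ℝ) : ℂ) * ((c * ϱ₀ / k : ℝ) : ℂ) = ((ϱ₀ : ℝ) : ℂ) := by
    rw [← Complex.ofReal_mul]
    congr 1
    field_simp
  calc ((k / c : ℝ) : ℂ) * conj (((‖A p‖⁻¹ : ℝ) : ℂ) * A p) * (((c * ϱ₀ / k : ℝ) : ℂ) * cx w)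
      = (((k / c : ℝ) : ℂ) * ((c * ϱ₀ / k : ℝ) : ℂ)) * conj (((‖A p‖⁻¹ : ℝ) : ℂ) * A p) * cx w := by
        ring
    _ = ((ϱ₀ : ℝ) : ℂ) * conj (((‖A p‖⁻¹ : ℝ) : ℂ) * A p) * cx w := by rw [hkc]

omit [TopologicalSpace F] [ChartedSpace (EuclideanSpace ℝ (Fin 2)) F]
  [ChartedSpace (EuclideanSpace ℝ (Fin 4)) X] in
include hcx hPt hN3 hk hNk in
/-- **Inner neck zone = second sheet's far piece at the Kervaire–Milnor partner.**  For
`0 < ‖A p‖ ≤ 1/4`, a point `x ∈ P.source` (the second sheet's tube point `T₂ (w, v′)`) whose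
plumbing coordinates are `(c′ r, b)` with `b = (1 - ‖A p‖) conj â` (the glue relation of the
surface) and `c′ r = c ϱ₀ conj b̂ · cx ṽ` (thin-arc coordinate of the reparametrised fibre) IS the
neck point `Nk (p, (c ϱ₀ / k) ṽ)`. [cite: AkhmedovPark2010, §3] [cite: KervaireMilnor1963, §2] -/
theorem neck_eq_arcFar {p : F} (hA0 : A p ≠ 0) (hAp : ‖A p‖ ≤ 1 / 4) {x : X} (hx : x ∈ P.source)
    {r b : ℂ} {c' ϱ₀ : ℝ} (hxP : toC2 (P x) = (((c' : ℝ) : ℂ) * r, b))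
    (hb : b = (((1 - ‖A p‖ : ℝ)) : ℂ) * conj (((‖A p‖⁻¹ : ℝ) : ℂ) * A p))
    (w : EuclideanSpace ℝ (Fin 2))
    (hr : ((c' : ℝ) : ℂ) * r = ((c * ϱ₀ : ℝ) : ℂ) * conj (((‖b‖⁻¹ : ℝ) : ℂ) * b) * cx w) :
    Nk (p, (c * ϱ₀ / k) • w) = x := by
  -- both points lie in `P.source`; compare their plumbing coordinates
  obtain ⟨hN, hmem⟩ := NeckPiece.toC2_neckPiece (hPt := hPt) (hNk := hNk) p ((c * ϱ₀ / k) • w)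
  have hlt : 0 < 1 - ‖A p‖ := by linarith
  obtain ⟨hu1, -⟩ := norm_unit hA0
  -- `conj b̂ = â`
  have hbu : conj (((‖b‖⁻¹ : ℝ) : ℂ) * b) = ((‖A p‖⁻¹ : ℝ) : ℂ) * A p := by
    rw [hb]; exact (unit_of_pos_mul hu1 hlt).2
  have hcoord : toC2 (P (Nk (p, (c * ϱ₀ / k) • w))) = toC2 (P x) := by
    rw [NeckPiece.toC2_neckPiece_of_le (hPt := hPt) (hN3 := hN3) (hNk := hNk) hAp, hxP, hr, hbu,
      NeckPiece.cx_smul hcx, hb]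
    congr 1
    · have hkc : ((k : ℝ) : ℂ) * ((c * ϱ₀ / k : ℝ) : ℂ) = ((c * ϱ₀ : ℝ) : ℂ) := by
        rw [← Complex.ofReal_mul]
        congr 1
        field_simp
      calc ((‖A p‖⁻¹ : ℝ) : ℂ) * A p * (((k : ℝ) : ℂ) * (((c * ϱ₀ / k : ℝ) : ℂ) * cx w))
          = (((k : ℝ) : ℂ) * ((c * ϱ₀ / k : ℝ) : ℂ)) * (((‖A p‖⁻¹ : ℝ) : ℂ) * A p) * cx w := by ring
        _ = ((c * ϱ₀ : ℝ) : ℂ) * (((‖A p‖⁻¹ : ℝ) : ℂ) * A p) * cx w := by rw [hkc]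
    · ring
  have hPeq : P (Nk (p, (c * ϱ₀ / k) • w)) = P x := toC2_injective hcoord
  exact P.injOn hmem hx hPeq

end Neck

/-! ### §2 The cap zones (plumbing chart `P = P₃` at the blown-up double point) -/

section Cap

variable {F : Type} [TopologicalSpace F] [ChartedSpace (EuclideanSpace ℝ (Fin 2)) F]
  {X : Type} [TopologicalSpace X] [ChartedSpace (EuclideanSpace ℝ (Fin 4)) X]
  {Z : Type*}
  {cx : EuclideanSpace ℝ (Fin 2) → ℂ} {vc : ℂ → EuclideanSpace ℝ (Fin 2)}
  {eF : OpenPartialHomeomorph F (EuclideanSpace ℝ (Fin 2))} {A : F → ℂ}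
  {P : OpenPartialHomeomorph X (EuclideanSpace ℝ (Fin 4))}
  {T : F × EuclideanSpace ℝ (Fin 2) → X} {c : ℝ}
  {C : ℂ × ℂ → ℂ × ℂ}
  {D : ConnectedSumData 4 X ComplexProjectivePlane}
  {jX : X → Z} {jP : ComplexProjectivePlane → Z}

variable (hcx : ∀ v, cx v = ⟨v 0, v 1⟩)
  (hvc : ∀ z, vc z = z.re • EuclideanSpace.single 0 (1 : ℝ) + z.im • EuclideanSpace.single 1 (1 : ℝ))
  (hPT : ∀ p, p ∈ eF.source → ∀ v : EuclideanSpace ℝ (Fin 2),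
    T (p, v) ∈ P.source ∧ toC2 (P (T (p, v))) = (A p, (c : ℂ) * cx v))
  (hC4 : ∀ a ν : ℂ, 2 / 3 ≤ ‖a‖ → C (a, ν) = (ν, conj (((‖a‖⁻¹ : ℝ) : ℂ) * a) *
      (Real.sqrt (1 + ‖ν‖ ^ 2) / (1 - ‖a‖ * Real.sqrt (1 + ‖ν‖ ^ 2)) : ℝ)))
  (hDe₁ : D.e₁ = P)
  (hDe₂ : D.e₂ = (affineChart (n := 2) 2 : OpenPartialHomeomorph ComplexProjectivePlane (EuclideanSpace ℝ (Fin 4))))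
  (hglue : ∀ x ∈ D.Φ.source, jX x = jP (D.Φ x))

omit [TopologicalSpace F] [ChartedSpace (EuclideanSpace ℝ (Fin 2)) F] in
include hDe₁ hDe₂ in
/-- **The Kervaire–Milnor map of `Z = X # ℂℙ²` on a point with prescribed plumbing coordinates**:
if `x ∈ P.source` and `P x = z` with `0 < ‖z‖ < 1`, then `x ∈ D.Φ.source` and
`D.Φ x = (affineChart 2)⁻¹ (ψ z)`. [cite: KervaireMilnor1963, §2] -/
theorem Φ_eq_of_apply_eq {x : X} (hx : x ∈ P.source) {z : EuclideanSpace ℝ (Fin 4)} (hz : P x = z)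
    (hz0 : 0 < ‖z‖) (hz1 : ‖z‖ < 1) :
    x ∈ D.Φ.source ∧ D.Φ x = (affineChart (n := 2) 2 : OpenPartialHomeomorph ComplexProjectivePlane
      (EuclideanSpace ℝ (Fin 4))).symm (discInversionFun z) := by
  constructor
  · rw [ConnectedSumData.mem_Φ_source, hDe₁, hz]
    exact ⟨hx, hz0, hz1⟩
  · rw [ConnectedSumData.Φ_apply]
    show D.e₂.symm (discInversionFun (D.e₁ x)) = _
    rw [hDe₁, hDe₂, hz]

omit [ChartedSpace (EuclideanSpace ℝ (Fin 2)) F] in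
include hcx hvc hPT hC4 hDe₁ hDe₂ hglue in
/-- **Far cap zone = first sheet's far piece (glued).**  For `2/3 ≤ ‖A p‖`, `ν = k₃ · cx ṽ` with
`‖A p‖ √(1 + ‖ν‖²) < 1`, and a multiplier with `Ψ p = (k₃ / c) A p`: the first sheet's tube point
`x = T (p, vc (Ψ p · cx ṽ))` has plumbing coordinates `(a, a ν)`, lies in the gluing annulus, and
its image in `Z` is the cap point `[1 : ν : conj â · s/(1 - ‖a‖ s)]` of `ℂℙ²`:
`jP ((affineChart 0)⁻¹ (C (A p, ν))) = jX x`. [cite: AkhmedovPark2010, §3] [cite: McDuffSalamon2017, Ex. 7.1.4 (ii)] -/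
theorem cap_eq_far (hc : c ≠ 0) {p : F} (hp : p ∈ eF.source) (hAp : 2 / 3 ≤ ‖A p‖) {k₃ : ℝ}
    (w : EuclideanSpace ℝ (Fin 2))
    (hlt : ‖A p‖ * Real.sqrt (1 + ‖((k₃ : ℝ) : ℂ) * cx w‖ ^ 2) < 1) {Ψ : F → ℂ}
    (hΨ : Ψ p = ((k₃ / c : ℝ) : ℂ) * A p) :
    T (p, vc (Ψ p * cx w)) ∈ D.Φ.source ∧
      D.Φ (T (p, vc (Ψ p * cx w))) = (affineChart (n := 2) 0 : OpenPartialHomeomorph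
        ComplexProjectivePlane (EuclideanSpace ℝ (Fin 4))).symm (fromC2 (C (A p, ((k₃ : ℝ) : ℂ) * cx w))) ∧
      jP ((affineChart (n := 2) 0 : OpenPartialHomeomorph ComplexProjectivePlane
        (EuclideanSpace ℝ (Fin 4))).symm (fromC2 (C (A p, ((k₃ : ℝ) : ℂ) * cx w)))) =
        jX (T (p, vc (Ψ p * cx w))) := by
  set ν : ℂ := ((k₃ : ℝ) : ℂ) * cx w with hν
  have ha0 : A p ≠ 0 := fun h => by rw [h, norm_zero] at hAp; norm_num at hAp
  obtain ⟨hmem, hcoord⟩ := hPT p hp (vc (Ψ p * cx w))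
  -- the plumbing coordinates of the tube point are `(a, a ν)`
  have hfib : (c : ℂ) * cx (vc (Ψ p * cx w)) = A p * ν := by
    rw [NeckPiece.cx_vc hcx hvc, hΨ, hν]
    have hcc : (c : ℂ) * ((k₃ / c : ℝ) : ℂ) = ((k₃ : ℝ) : ℂ) := by
      rw [← Complex.ofReal_mul]; congr 1; field_simp
    calc (c : ℂ) * (((k₃ / c : ℝ) : ℂ) * A p * cx w) = ((c : ℂ) * ((k₃ / c : ℝ) : ℂ)) * A p * cx w := by ring
      _ = A p * (((k₃ : ℝ) : ℂ) * cx w) := by rw [hcc]; ring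
  have hPx : P (T (p, vc (Ψ p * cx w))) = fromC2 (A p, A p * ν) := by
    apply toC2_injective; rw [hcoord, toC2_fromC2, hfib]
  have hnorm := BlowUpCap.norm_fromC2_sheetTube (A p) ν
  have hz0 : 0 < ‖fromC2 (A p, A p * ν)‖ := by
    rw [hnorm]; exact mul_pos (norm_pos_iff.2 ha0) (Real.sqrt_pos.2 (by positivity))
  have hz1 : ‖fromC2 (A p, A p * ν)‖ < 1 := by rw [hnorm]; exact hlt
  obtain ⟨hsrc, hΦ⟩ := Φ_eq_of_apply_eq hDe₁ hDe₂ hmem hPx hz0 hz1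
  have hcap : D.Φ (T (p, vc (Ψ p * cx w))) = (affineChart (n := 2) 0 : OpenPartialHomeomorph
      ComplexProjectivePlane (EuclideanSpace ℝ (Fin 4))).symm (fromC2 (C (A p, ν))) := by
    rw [hΦ, BlowUpCap.affineChart_two_symm_discInversion_sheetTube ha0 hlt, hC4 _ _ hAp]
  exact ⟨hsrc, hcap, by rw [← hcap, hglue _ hsrc]⟩

omit [TopologicalSpace F] [ChartedSpace (EuclideanSpace ℝ (Fin 2)) F] in
include hC4 hDe₁ hDe₂ hglue in
/-- **Far cap zone of the second sheet = its far piece (glued).**  A point `x ∈ P.source` with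
plumbing coordinates `(b ν, b)` (the second sheet's tube point `T₂ (w, v′)`: `c′ r(v′) = b ν`),
`2/3 ≤ ‖b‖`, `‖b‖ √(1 + ‖ν‖²) < 1`, lies in the gluing annulus and its image in `Z` is the second
cap's point `[ν : 1 : conj b̂ · s/(1 - ‖b‖ s)]`:  `jP ((affineChart 1)⁻¹ (C (b, ν))) = jX x`.
[cite: AkhmedovPark2010, §3] [cite: McDuffSalamon2017, Ex. 7.1.4 (ii)] -/
theorem cap₂_eq_arcFar {x : X} (hx : x ∈ P.source) {b ν : ℂ} (hb : 2 / 3 ≤ ‖b‖)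
    (hxP : toC2 (P x) = (b * ν, b)) (hlt : ‖b‖ * Real.sqrt (1 + ‖ν‖ ^ 2) < 1) :
    x ∈ D.Φ.source ∧
      D.Φ x = (affineChart (n := 2) 1 : OpenPartialHomeomorph ComplexProjectivePlane
        (EuclideanSpace ℝ (Fin 4))).symm (fromC2 (C (b, ν))) ∧
      jP ((affineChart (n := 2) 1 : OpenPartialHomeomorph ComplexProjectivePlane
        (EuclideanSpace ℝ (Fin 4))).symm (fromC2 (C (b, ν)))) = jX x := by
  have hb0 : b ≠ 0 := fun h => by rw [h, norm_zero] at hb; norm_num at hb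
  have hPx : P x = fromC2 (b * ν, b) := by
    apply toC2_injective; rw [hxP, toC2_fromC2]
  have hnorm := BlowUpCap.norm_fromC2_sheetTube₂ b ν
  have hz0 : 0 < ‖fromC2 (b * ν, b)‖ := by
    rw [hnorm]; exact mul_pos (norm_pos_iff.2 hb0) (Real.sqrt_pos.2 (by positivity))
  have hz1 : ‖fromC2 (b * ν, b)‖ < 1 := by rw [hnorm]; exact hlt
  obtain ⟨hsrc, hΦ⟩ := Φ_eq_of_apply_eq hDe₁ hDe₂ hx hPx hz0 hz1
  have hcap : D.Φ x = (affineChart (n := 2) 1 : OpenPartialHomeomorph ComplexProjectivePlane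
      (EuclideanSpace ℝ (Fin 4))).symm (fromC2 (C (b, ν))) := by
    rw [hΦ, BlowUpCap.affineChart_two_symm_discInversion_sheetTube₂ hb0 hlt, hC4 _ _ hb]
  exact ⟨hsrc, hcap, by rw [← hcap, hglue _ hsrc]⟩

omit [TopologicalSpace F] [ChartedSpace (EuclideanSpace ℝ (Fin 2)) F] in
include hDe₁ in
/-- **Points outside the gluing ball are not glued**: if `x ∈ P.source` has `‖P x‖ ≥ 1`, or
`x ∉ P.source`, then `x ∉ D.Φ.source`. [cite: KervaireMilnor1963, §2] -/
theorem not_mem_Φ_source {x : X} (h : x ∈ P.source → 1 ≤ ‖P x‖) : x ∉ D.Φ.source := by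
  rw [ConnectedSumData.mem_Φ_source, hDe₁]
  rintro ⟨hx, -, h1⟩
  exact absurd (h hx) (not_le.2 h1)

end Cap

end TubeZones

end Literature.Topology.FourManifolds
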